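import Summits.QuantumFields.BalabanUV.T4Continuum.Support.VariationalColourUpperBound

/-!
# T⁴ programme, spine node NE2 (U1a), lane P2 — SUPPLIER LEAF V-UB, CORE: the TILTED, SPILL-FREE in-block trial 1-FORM for Bałaban's (1.18)
# line-sum averaging of vector fields, and its EXACT constraint `Q_v ψ_φ = κ • φ` with a k-UNIFORM constant `κ ∈ [6^{1−d}/60, 1]`

NE2 formalisation swarm `b2b-balaban-t4-ne2-formalise-*`, leaf 03 GEN 4 (`prover-b2b-balaban-t4-ne2-formalise-leaf-03-g4-0`), SUPPLIER SEAT for row V-UB of the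
P2 (variational) skeleton `t4/skeletons/NE2-t4-ne2-p2.md` v0.11 §2.E («X8(U)(B) ≤ Λ_V·nsq B directly at every level — local competitor for 1-forms»); journal
INTENT CLAIMS.log 2026-08-20 ≈10:31Z.  File 1 of the V-UB line: the U = 1 ∕ transport-free core (the covariant∕colour dressing on per-bond transports and the
energy bounds follow in sequels, pattern of `VariationalColourUpperBound`).

THE LOCATED POINT (ours, about OUR competitor design — not an objection to anything printed or landed).  The U = 1 carrier of Q_k on 1-forms is the tree's
`B5Block118.QvOp` ([Balaban1984PropagatorsI] (1.18) p.20: `(Q_kA)(y,μ) = n^{−(d+1)} Σ_{x∈B(y)} Σ_{t<n} A(x + t e_μ, μ)`).  The straight lines of length `n`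
started in the block `B(y)` SPILL into `B(y + e_μ)`: a fine bond `(z, μ)` with `μ`-digit `t_z` is met `t_z + 1` times by lines of its own block and
`n − 1 − t_z` times by lines of the block BEHIND it (`sum_window`: the tent of (1.18)).  So the scalar leaf's recipe «bump componentwise on bonds» does NOT
meet the vector constraint block-locally (a nonnegative weight spills `Σ_t (n−1−t)·b(t) > 0` into the neighbour; only sheet-supported weights `t_z = n−1` are
spill-free, and they are rough in direction `μ`).  REPAIR: a SIGNED smooth weight with ZERO SPILL MOMENT — the product bump of leaf-09 TILTED in the bond's
own direction,
    `ω_μ(j) := W(j)·a(j_μ)`,   `a(t) := (t − t₀)/n`,   **`t₀ := 2(n − 2)/5`**,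
for which (exact rational identities from four power sums, §1–§2)
    `Σ_{t<n} (n−1−t)·b(t)·a(t) = 0`   (`spill_eq_zero`)   and   `Σ_{t<n} (t+1)·b(t)·a(t) = m(n) := (n+1)(n+2)(n+3)/(60n)`   (`main_eq`).

CONTENT ([folklore]; `φ : Tor M → Fin d → E`, `E` ANY normed ℂ-space; lattice units): §1 four power sums (induction + `ring`); §2 `t0`, `tilt` (`|a| ≤ 1`,
`n·Δa = 1`), `spill_eq_zero`, `main_eq`, `mV_bounds`; §3 `sum_range_triangle`, **`sum_window`** `Σ_{i<n}Σ_{t<n} h(i+t) = Σ_{s<n}(s+1)•h s + Σ_{s<n}(n−1−s)•h(n+s)`;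
§4 `trialV φ x μ := (W(digits x)·a(digit_μ x)) • φ(block x, μ)`, the function-level average `QvV n M W y μ := n^{−(d+1)} • Σ_j Σ_{t<n} W(n·y + j + t e_μ, μ)`
(**`QvV_eq_QvOp`**: at `E = ℂ` it IS `QvOp *ᵥ`), the line points (`line_point_lt`: parameter `s < n` ↦ own block, digit `s`; `line_point_ge`: `n + s` ↦ block
`y + e_μ`, digit `s`; via leaf-09's `bpt_update'` and `B5Block118.bpt_add_tstep`); §5 **`line_window_sum`** (one transverse fibre: the `n` lines deposit
`m(n)·Π_{ν≠μ}b(q_ν)` in the own block and NOTHING in the next), `sum_transverse_mass` (`= (nβ₁)^{d−1}`), **`QvV_trialV : QvV n M (trialV φ) = fun y μ ↦ κ • φ y μ`**,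
`κ = kappaV d n := n^{−(d+1)}·m(n)·(nβ₁)^{d−1}`; §6 `kappaV_eq`, **`kappaV_bounds : 6^{−(d−1)}/60 ≤ κ ≤ 1`** (k-UNIFORM), `kappaV_pos`.  So `κ⁻¹ • ψ_φ` meets
`Q_v W = φ` EXACTLY, block-locally, with weights `≤ 60·6^{d−1}` and a lattice-smooth profile in EVERY direction incl. `μ` — V-UB's engine for ANY first-order form.

HONEST FRAMING (T4-DAG p. 1).  Model level; U = 1 ∕ transport-free; nothing about the vector form S_U (the owner's V-D∕V-P), nothing about Bałaban's minimisers,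
no identification with [B9] (3.13)'s Q(U) beyond the U = 1 SHAPE (1.18) (c5); nothing printed is a hypothesis; data `def`s `t0`, `tilt`, `mV`, `trialV`, `QvV`,
`kappaV`, no `def … : Prop`, no `sorry`; axioms standard.  NE2 NOT proved; spine 0/9; rung (B)+1 finite T⁴ — NOT infinite volume, NOT mass gap, NOT Clay.
HONEST DEPENDENCY (cell, verbatim): continuum YM on T⁴ ⇐ BetaPertH ∧ nine spine estimates (0/9 proved); BetaPertH ⇐ (D1) ∧ (D4) ∧ CAP+tail; G-an2-4 gates
asym, D1 and NE2/3/4.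
-/

noncomputable section

namespace Summit.QuantumFields.BalabanUV.T4Continuum.VectorBlockTrialForm

open Finset
open scoped ComplexConjugate Matrix
open Literature.MathematicalPhysics.QuantumFieldTheory.Balaban1983to89
open Literature.MathematicalPhysics.QuantumFieldTheory.Balaban1983to89.B5Prop11Plancherel (Tor fine unitVec)
open Literature.MathematicalPhysics.QuantumFieldTheory.Balaban1983to89.B5Block118 (tstep tstep_zero tstep_succ bpt bpt_add_tstep lineSum QvOp QvOp_mulVec)
open Literature.MathematicalPhysics.QuantumFieldTheory.Balaban1983to89.B5Blocks16 (blockOf blockOf_bpt)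
open Summit.QuantumFields.BalabanUV.T4Continuum.ScalarBlockTrialFunction
  (digits digits_bpt bump bump_mem bump_face abs_bump_step_le six_mul_sum_eq beta1 beta1_ge avg_bump_eq bumpW bumpW_mem bumpW_update
   prod_erase_mem sum_bumpW_eq bpt_add_unitVec_of_lt bpt_add_unitVec_of_eq bpt_update')
open Summit.QuantumFields.BalabanUV.T4Continuum.VariationalColourUpperBound (nsqv nsqv_nonneg)

variable {d : ℕ}

/-! ## §1 Four power sums `Σ_{t<n} t^k (t+1)`, `k = 0, 1, 2, 3` (the bump mass itself is leaf-09's `sum_bump_eq`) -/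

/-- the four power sums in closed form: `Σ(t+1) = n(n+1)/2`, `Σ t(t+1) = (n−1)n(n+1)/3`, `Σ t²(t+1) = (n−1)n(n+1)(3n−2)/12`,
`Σ t³(t+1) = (n−1)n(n+1)(12n²−15n+2)/60` (sums over `t < n`). [folklore] -/
theorem sums_closed (n : ℕ) :
    ∑ t ∈ range n, ((t : ℝ) + 1) = (n : ℝ) * (n + 1) / 2 ∧
    ∑ t ∈ range n, (t : ℝ) * ((t : ℝ) + 1) = ((n : ℝ) - 1) * n * (n + 1) / 3 ∧
    ∑ t ∈ range n, (t : ℝ) ^ 2 * ((t : ℝ) + 1) = ((n : ℝ) - 1) * n * (n + 1) * (3 * n - 2) / 12 ∧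
    ∑ t ∈ range n, (t : ℝ) ^ 3 * ((t : ℝ) + 1) = ((n : ℝ) - 1) * n * (n + 1) * (12 * (n : ℝ) ^ 2 - 15 * n + 2) / 60 := by
  refine ⟨?_, ?_, ?_, ?_⟩ <;>
  · induction n with
    | zero => simp
    | succ n ih => rw [sum_range_succ, ih]; push_cast; ring

/-! ## §2 The tilt `a(t) = (t − t₀)/n`, `t₀ = 2(n−2)/5`: bounded by one, unit steps, ZERO SPILL MOMENT, explicit main moment -/

/-- the tilt centre `t₀ = 2(n − 2)/5` — the unique centre making the spill moment `Σ_t (n−1−t)·b(t)·(t − t₀)` vanish. [folklore] -/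
def t0 (n : ℕ) : ℝ := 2 * ((n : ℝ) - 2) / 5

/-- the TILT `a(t) = (t − t₀)/n`. [folklore] -/
def tilt (n : ℕ) (t : ℕ) : ℝ := ((t : ℝ) - t0 n) / n

/-- `|a(t)| ≤ 1` for `t < n`. [folklore] -/
theorem abs_tilt_le_one {n : ℕ} (t : ℕ) (ht : t < n) : |tilt n t| ≤ 1 := by
  have hn : (0 : ℝ) < n := by exact_mod_cast Nat.zero_lt_of_lt ht
  have ht' : (t : ℝ) + 1 ≤ n := by exact_mod_cast ht
  have ht0 : (0 : ℝ) ≤ t := Nat.cast_nonneg t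
  unfold tilt t0
  rw [abs_div, abs_of_pos hn, div_le_one hn, abs_le]
  constructor <;> nlinarith

/-- unit steps: `n·(a(t+1) − a(t)) = 1`. [folklore] -/
theorem tilt_step {n : ℕ} (hn : 0 < n) (t : ℕ) : (n : ℝ) * (tilt n (t + 1) - tilt n t) = 1 := by
  have hn' : (n : ℝ) ≠ 0 := by exact_mod_cast hn.ne'
  unfold tilt; push_cast; field_simp; ring

/-- **ZERO SPILL MOMENT**: `Σ_{t<n} (n − 1 − t)·b(t)·a(t) = 0` — the weight the tilted bump's line sums deposit in the block BEHIND vanishes exactly. [folklore] -/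
theorem spill_eq_zero {n : ℕ} (hn : 0 < n) : ∑ t ∈ range n, ((n : ℝ) - 1 - t) * bump n t * tilt n t = 0 := by
  have hn' : (n : ℝ) ≠ 0 := by exact_mod_cast hn.ne'
  obtain ⟨hA1, hA2, hA3, hA4⟩ := sums_closed n
  have key : ∀ t : ℕ, ((n : ℝ) - 1 - t) * bump n t * tilt n t
      = ((n : ℝ) ^ 3)⁻¹ * ((t : ℝ) ^ 3 * ((t : ℝ) + 1)) + (((n : ℝ) ^ 3)⁻¹ * (-(2 * n - 1 + t0 n))) * ((t : ℝ) ^ 2 * ((t : ℝ) + 1))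
        + (((n : ℝ) ^ 3)⁻¹ * ((n : ℝ) * (n - 1) + t0 n * (2 * n - 1))) * ((t : ℝ) * ((t : ℝ) + 1))
        + (((n : ℝ) ^ 3)⁻¹ * (-(t0 n * n * (n - 1)))) * ((t : ℝ) + 1) := by
    intro t; unfold bump tilt; field_simp; ring
  rw [sum_congr rfl fun t _ => key t, sum_add_distrib, sum_add_distrib, sum_add_distrib, ← mul_sum, ← mul_sum, ← mul_sum, ← mul_sum,
    hA1, hA2, hA3, hA4]
  unfold t0
  field_simp
  ring

/-- the MAIN MOMENT `m(n) = (n+1)(n+2)(n+3)/(60n)`. [folklore] -/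
def mV (n : ℕ) : ℝ := ((n : ℝ) + 1) * ((n : ℝ) + 2) * ((n : ℝ) + 3) / (60 * n)

/-- **MAIN MOMENT**: `Σ_{t<n} (t + 1)·b(t)·a(t) = (n+1)(n+2)(n+3)/(60n)` — the weight deposited in the OWN block. [folklore] -/
theorem main_eq {n : ℕ} (hn : 0 < n) : ∑ t ∈ range n, ((t : ℝ) + 1) * bump n t * tilt n t = mV n := by
  have hn' : (n : ℝ) ≠ 0 := by exact_mod_cast hn.ne'
  obtain ⟨hA1, hA2, hA3, hA4⟩ := sums_closed n
  have key : ∀ t : ℕ, ((t : ℝ) + 1) * bump n t * tilt n t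
      = (((n : ℝ) ^ 3)⁻¹ * (-1)) * ((t : ℝ) ^ 3 * ((t : ℝ) + 1)) + (((n : ℝ) ^ 3)⁻¹ * ((n : ℝ) - 1 + t0 n)) * ((t : ℝ) ^ 2 * ((t : ℝ) + 1))
        + (((n : ℝ) ^ 3)⁻¹ * ((n : ℝ) - t0 n * (n - 1))) * ((t : ℝ) * ((t : ℝ) + 1))
        + (((n : ℝ) ^ 3)⁻¹ * (-(t0 n * n))) * ((t : ℝ) + 1) := by
    intro t; unfold bump tilt; field_simp; ring
  rw [sum_congr rfl fun t _ => key t, sum_add_distrib, sum_add_distrib, sum_add_distrib, ← mul_sum, ← mul_sum, ← mul_sum, ← mul_sum,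
    hA1, hA2, hA3, hA4]
  unfold t0 mV
  field_simp
  ring

/-- `2/5 ≤ m(n)/1`… precisely `m(n) ≥ n²/60` and `m(n) ≤ 2n²/5`: the main moment is of exact order `n²`. [folklore] -/
theorem mV_bounds {n : ℕ} (hn : 0 < n) : (n : ℝ) ^ 2 / 60 ≤ mV n ∧ mV n ≤ 2 * (n : ℝ) ^ 2 / 5 := by
  have hn' : (0 : ℝ) < n := by exact_mod_cast hn
  have h1 : (1 : ℝ) ≤ n := by exact_mod_cast hn
  unfold mV
  constructor
  · rw [div_le_div_iff₀ (by norm_num) (by positivity)]; nlinarith [mul_nonneg (mul_nonneg hn'.le hn'.le) hn'.le]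
  · rw [div_le_div_iff₀ (by positivity) (by norm_num)]; nlinarith [mul_nonneg (mul_nonneg hn'.le hn'.le) hn'.le, mul_nonneg hn'.le hn'.le]

/-! ## §3 Two counting lemmas: the triangle count and the WINDOW COUNT of the line sums -/

/-- triangle count: `Σ_{i<n} Σ_{u<i} g u = Σ_{u<n} (n − 1 − u) • g u`. [folklore] -/
theorem sum_range_triangle {β : Type*} [AddCommMonoid β] (g : ℕ → β) (n : ℕ) :
    ∑ i ∈ range n, ∑ u ∈ range i, g u = ∑ u ∈ range n, (n - 1 - u) • g u := by
  induction n with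
  | zero => simp
  | succ n ih =>
    rw [sum_range_succ, ih, sum_range_succ, ← sum_add_distrib]
    have h0 : (n + 1 - 1 - n) • g n = 0 := by simp
    rw [h0, add_zero]
    refine sum_congr rfl fun u hu => ?_
    rw [mem_range] at hu
    rw [← succ_nsmul]
    congr 1
    omega

/-- **WINDOW COUNT**: `Σ_{i<n} Σ_{t<n} h(i + t) = Σ_{s<n} (s + 1) • h s + Σ_{s<n} (n − 1 − s) • h (n + s)` — the `n` windows of length `n` started at
`i < n` cover the point `s < n` exactly `s + 1` times and the point `n + s` exactly `n − 1 − s` times (the TENT of (1.18)'s line sums). [folklore] -/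
theorem sum_window {β : Type*} [AddCommGroup β] (h : ℕ → β) (n : ℕ) :
    ∑ i ∈ range n, ∑ t ∈ range n, h (i + t) = ∑ s ∈ range n, (s + 1) • h s + ∑ s ∈ range n, (n - 1 - s) • h (n + s) := by
  have hrow : ∀ i ∈ range n, ∑ t ∈ range n, h (i + t) = ∑ s ∈ range n, h s + ∑ k ∈ range i, h (n + k) - ∑ s ∈ range i, h s := by
    intro i _
    have h1 : ∑ s ∈ range (i + n), h s = ∑ s ∈ range i, h s + ∑ t ∈ range n, h (i + t) := sum_range_add h i n
    have h2 : ∑ s ∈ range (n + i), h s = ∑ s ∈ range n, h s + ∑ k ∈ range i, h (n + k) := sum_range_add h n i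
    rw [add_comm i n, h2] at h1
    rw [h1, add_sub_cancel_left]
  rw [sum_congr rfl hrow, sum_sub_distrib, sum_add_distrib, sum_const, card_range, sum_range_triangle, sum_range_triangle,
    add_sub_right_comm, smul_sum, ← sum_sub_distrib]
  congr 1
  refine sum_congr rfl fun s hs => ?_
  rw [mem_range] at hs
  rw [sub_eq_iff_eq_add, ← add_nsmul]
  congr 1
  omega

/-! ## §4 The tilted trial 1-form `ψ_φ(n·y + j, μ) = W(j)·a(j_μ) • φ(y, μ)` and the (1.18) line-sum average of `E`-valued 1-forms -/

section Trial

variable (n : ℕ) [NeZero n] (M : Fin d → ℕ) [hM : ∀ μ, NeZero (M μ)]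
variable {E : Type*} [NormedAddCommGroup E] [NormedSpace ℂ E]

/-- **the tilted trial 1-form** `ψ_φ(x, μ) = W(digits x)·a(digit_μ x) • φ(block x, μ)` — leaf-09's product bump `W` times the TILT in the bond's own direction. [folklore] -/
def trialV (φ : Tor M → Fin d → E) (x : Tor (fine n M)) (μ : Fin d) : E :=
  ((bumpW n (digits n M x) * tilt n (digits n M x μ) : ℝ) : ℂ) • φ (blockOf n M x) μ

/-- `ψ_φ(n·y + j, μ) = W(j)·a(j_μ) • φ(y, μ)`. [folklore] -/
theorem trialV_bpt (φ : Tor M → Fin d → E) (y : Tor M) (j : Fin d → Fin n) (μ : Fin d) :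
    trialV n M φ (bpt n M y j) μ = ((bumpW n j * tilt n (j μ) : ℝ) : ℂ) • φ y μ := by
  rw [trialV, blockOf_bpt, digits_bpt]

omit [NeZero n] in
/-- the weights are bounded by one: `|W(j)·a(j_μ)| ≤ 1`. [folklore] -/
theorem abs_weight_le_one (j : Fin d → Fin n) (μ : Fin d) : |bumpW n j * tilt n (j μ)| ≤ 1 := by
  rw [abs_mul, abs_of_nonneg (bumpW_mem n j).1]
  exact mul_le_one₀ (bumpW_mem n j).2 (abs_nonneg _) (abs_tilt_le_one _ (j μ).is_lt)

/-- **the (1.18) LINE-SUM AVERAGE of an `E`-valued 1-form**: `(Q_v W)(y, μ) = n^{−(d+1)} • Σ_{j} Σ_{t<n} W(n·y + j + t e_μ, μ)` — straight lines of length `n`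
started at every site of the block ([Balaban1984PropagatorsI] (1.18) p.20 SHAPE; at `E = ℂ` literally the tree's `B5Block118.QvOp`, below). [folklore] -/
def QvV (W : Tor (fine n M) → Fin d → E) (y : Tor M) (μ : Fin d) : E :=
  (((n : ℂ) ^ (d + 1))⁻¹ : ℂ) • ∑ j : Fin d → Fin n, ∑ t : Fin n, W (bpt n M y j + tstep (fine n M) μ t) μ

/-- at `E = ℂ` the line-sum average IS the tree's `QvOp` ([B5] (1.18)): `QvV W y μ = (QvOp *ᵥ W♭)(y, μ)`. [folklore] -/
theorem QvV_eq_QvOp (W : Tor (fine n M) → Fin d → ℂ) (y : Tor M) (μ : Fin d) :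
    QvV n M W y μ = (QvOp n M *ᵥ (fun p => W p.1 p.2)) (y, μ) := by
  rw [QvOp_mulVec, QvV, smul_eq_mul, one_div]
  rfl

omit [NeZero n] hM in
/-- `tstep` is additive in the number of steps. [folklore] -/
theorem tstep_add (μ : Fin d) (a b : ℕ) : tstep (fine n M) μ (a + b) = tstep (fine n M) μ a + tstep (fine n M) μ b := by
  induction b with
  | zero => rw [add_zero, tstep_zero, add_zero]
  | succ b ih => rw [← add_assoc, tstep_succ, ih, tstep_succ, add_assoc]

omit hM in
/-- a point of the straight line from `n·y + j₀` (`j₀_μ = 0`) at parameter `s < n` is the block point with `μ`-digit `s`. [folklore] -/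
theorem line_point_lt (y : Tor M) {j₀ : Fin d → Fin n} {μ : Fin d} (hj : j₀ μ = 0) (s : ℕ) (hs : s < n) :
    bpt n M y j₀ + tstep (fine n M) μ s = bpt n M y (Function.update j₀ μ ⟨s, hs⟩) := by
  rw [bpt_update' n M y j₀ μ ⟨s, hs⟩]
  have h0 : Function.update j₀ μ (0 : Fin n) = j₀ := by rw [← hj, Function.update_eq_self]
  rw [h0]

omit hM in
/-- … and at parameter `n + s`, `s < n`, it is the block point of the NEXT block `y + e_μ` with `μ`-digit `s` (the spill). [folklore] -/
theorem line_point_ge (y : Tor M) {j₀ : Fin d → Fin n} {μ : Fin d} (hj : j₀ μ = 0) (s : ℕ) (hs : s < n) :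
    bpt n M y j₀ + tstep (fine n M) μ (n + s) = bpt n M (y + unitVec M μ) (Function.update j₀ μ ⟨s, hs⟩) := by
  rw [tstep_add, ← add_assoc, bpt_add_tstep, line_point_lt n M (y + unitVec M μ) hj s hs]

/-- the trial form on the line from `n·y + j₀`: own block, parameter `s < n`. [folklore] -/
theorem trialV_line_lt (φ : Tor M → Fin d → E) (y : Tor M) {j₀ : Fin d → Fin n} {μ : Fin d} (hj : j₀ μ = 0) (s : ℕ) (hs : s < n) :
    trialV n M φ (bpt n M y j₀ + tstep (fine n M) μ s) μ
      = ((bump n s * (∏ ν ∈ univ.erase μ, bump n (j₀ ν)) * tilt n s : ℝ) : ℂ) • φ y μ := by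
  rw [line_point_lt n M y hj s hs, trialV_bpt, (bumpW_update n j₀ μ ⟨s, hs⟩).1, Function.update_self]

/-- the trial form on the line from `n·y + j₀`: next block, parameter `n + s`. [folklore] -/
theorem trialV_line_ge (φ : Tor M → Fin d → E) (y : Tor M) {j₀ : Fin d → Fin n} {μ : Fin d} (hj : j₀ μ = 0) (s : ℕ) (hs : s < n) :
    trialV n M φ (bpt n M y j₀ + tstep (fine n M) μ (n + s)) μ
      = ((bump n s * (∏ ν ∈ univ.erase μ, bump n (j₀ ν)) * tilt n s : ℝ) : ℂ) • φ (y + unitVec M μ) μ := by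
  rw [line_point_ge n M y hj s hs, trialV_bpt, (bumpW_update n j₀ μ ⟨s, hs⟩).1, Function.update_self]

end Trial

/-! ## §5 THE EXACT CONSTRAINT `Q_v ψ_φ = κ • φ`, `κ = β₁^{d−1}·(n+1)(n+2)(n+3)/(60 n³) ∈ [6^{1−d}/60, 1]` -/

section Constraint

variable (n : ℕ) [NeZero n] (M : Fin d → ℕ) [hM : ∀ μ, NeZero (M μ)]
variable {E : Type*} [NormedAddCommGroup E] [NormedSpace ℂ E]

/-- the CONSTRAINT CONSTANT `κ = n^{−(d+1)}·m(n)·(nβ₁)^{d−1}` (the form that falls out of the computation; `= β₁^{d−1}(n+1)(n+2)(n+3)/(60n³)`, below). [folklore] -/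
def kappaV (d n : ℕ) : ℝ := ((n : ℝ) ^ (d + 1))⁻¹ * mV n * ((n : ℝ) * beta1 n) ^ (d - 1)

omit hM in
/-- splitting an offset `j` into its `μ`-digit and the others: `symm (i, q) = update (symm (0, q)) μ i`, and `symm (0, q)` has `μ`-digit `0`. [folklore] -/
theorem funSplitAt_symm_eq (μ : Fin d) (i : Fin n) (q : {ν // ν ≠ μ} → Fin n) :
    (Equiv.funSplitAt μ (Fin n)).symm (i, q) = Function.update ((Equiv.funSplitAt μ (Fin n)).symm (0, q)) μ i ∧
      ((Equiv.funSplitAt μ (Fin n)).symm (0, q)) μ = 0 := by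
  refine ⟨funext fun ν => ?_, by simp⟩
  by_cases h : ν = μ
  · subst h; simp
  · simp [h]

/-- **THE WINDOW SUM OF ONE TRANSVERSE FIBRE**: for fixed transverse digits `q`, summing the trial form over the `n` lines started at `μ`-digits `i < n`
deposits `m(n)·Π_{ν≠μ} b(q_ν)` in the OWN block and — by the zero spill moment — NOTHING in the next block. [folklore] -/
theorem line_window_sum (φ : Tor M → Fin d → E) (y : Tor M) (μ : Fin d) (q : {ν // ν ≠ μ} → Fin n) :
    ∑ i : Fin n, ∑ t : Fin n, trialV n M φ (bpt n M y ((Equiv.funSplitAt μ (Fin n)).symm (i, q)) + tstep (fine n M) μ t) μ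
      = ((mV n * ∏ ν ∈ univ.erase μ, bump n (((Equiv.funSplitAt μ (Fin n)).symm (0, q)) ν) : ℝ) : ℂ) • φ y μ := by
  have hn : 0 < n := Nat.pos_of_ne_zero (NeZero.ne n)
  set j₀ : Fin d → Fin n := (Equiv.funSplitAt μ (Fin n)).symm (0, q) with hj₀
  set R : ℝ := ∏ ν ∈ univ.erase μ, bump n (j₀ ν) with hR
  have hj : j₀ μ = 0 := (funSplitAt_symm_eq n μ 0 q).2
  set h : ℕ → E := fun s => trialV n M φ (bpt n M y j₀ + tstep (fine n M) μ s) μ with hh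
  -- the double sum is a window sum of `h`
  have step1 : ∑ i : Fin n, ∑ t : Fin n, trialV n M φ (bpt n M y ((Equiv.funSplitAt μ (Fin n)).symm (i, q)) + tstep (fine n M) μ t) μ
      = ∑ i ∈ range n, ∑ t ∈ range n, h (i + t) := by
    rw [Finset.sum_range (fun i => ∑ t ∈ range n, h (i + t))]
    refine Fintype.sum_congr _ _ fun i => ?_
    rw [Finset.sum_range (fun t => h (i + t))]
    refine Fintype.sum_congr _ _ fun t => ?_
    rw [(funSplitAt_symm_eq n μ i q).1, hh]
    simp only
    rw [tstep_add, ← add_assoc, line_point_lt n M y hj i i.is_lt]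
  -- the two windows
  have hw1 : ∀ s ∈ range n, (s + 1) • h s = (((s : ℝ) + 1) * bump n s * tilt n s * R : ℝ) • φ y μ := by
    intro s hs
    rw [mem_range] at hs
    rw [hh]; simp only
    rw [trialV_line_lt n M φ y hj s hs, ← Nat.cast_smul_eq_nsmul ℝ, ← hR, Complex.coe_smul, smul_smul]
    congr 1; push_cast; ring
  have hw2 : ∀ s ∈ range n, (n - 1 - s) • h (n + s) = ((((n : ℝ) - 1 - s) * bump n s * tilt n s * R : ℝ)) • φ (y + unitVec M μ) μ := by
    intro s hs
    rw [mem_range] at hs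
    have hc : ((n - 1 - s : ℕ) : ℝ) = (n : ℝ) - 1 - s := by
      have e : (n - 1 - s) + s + 1 = n := by omega
      have e' := congrArg (Nat.cast : ℕ → ℝ) e
      push_cast at e'
      linarith
    rw [hh]; simp only
    rw [trialV_line_ge n M φ y hj s hs, ← Nat.cast_smul_eq_nsmul ℝ, hc, ← hR, Complex.coe_smul, smul_smul]
    congr 1; ring
  rw [step1, sum_window, sum_congr rfl hw1, sum_congr rfl hw2, ← Finset.sum_smul, ← Finset.sum_smul]
  have e1 : ∑ s ∈ range n, ((s : ℝ) + 1) * bump n s * tilt n s * R = mV n * R := by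
    rw [← Finset.sum_mul, main_eq hn]
  have e2 : ∑ s ∈ range n, ((n : ℝ) - 1 - s) * bump n s * tilt n s * R = 0 := by
    rw [← Finset.sum_mul, spill_eq_zero hn, zero_mul]
  rw [e1, e2, zero_smul, add_zero, Complex.coe_smul]

omit hM in
/-- the transverse bump masses: `Σ_{q} Π_{ν≠μ} b(q_ν) = (n·β₁)^{d−1}`. [folklore] -/
theorem sum_transverse_mass (μ : Fin d) :
    ∑ q : {ν // ν ≠ μ} → Fin n, ∏ ν ∈ univ.erase μ, bump n (((Equiv.funSplitAt μ (Fin n)).symm (0, q)) ν) = ((n : ℝ) * beta1 n) ^ (d - 1) := by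
  have hprod : ∀ q : {ν // ν ≠ μ} → Fin n,
      ∏ ν ∈ univ.erase μ, bump n (((Equiv.funSplitAt μ (Fin n)).symm (0, q)) ν) = ∏ ν' : {ν // ν ≠ μ}, bump n (q ν') := by
    intro q
    rw [Finset.prod_subtype (univ.erase μ) (p := fun ν => ν ≠ μ) (fun ν => by simp [mem_erase])]
    refine Fintype.prod_congr _ _ fun ν' => ?_
    simp [ν'.2]
  simp_rw [hprod]
  rw [← Fintype.prod_sum (fun (_ : {ν // ν ≠ μ}) (t : Fin n) => bump n t)]
  have hmass : ∑ t : Fin n, bump n t = (n : ℝ) * beta1 n := by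
    have h := avg_bump_eq n
    have hn' : (n : ℝ) ≠ 0 := by exact_mod_cast NeZero.ne n
    rw [← h, ← mul_assoc, mul_inv_cancel₀ hn', one_mul]
  rw [Finset.prod_const, Finset.card_univ, hmass]
  congr 1
  have hcard : Fintype.card {ν : Fin d // ν ≠ μ} + 1 = d := by
    rw [Fintype.card_subtype_compl, Fintype.card_fin, Fintype.card_subtype_eq]
    have : 1 ≤ d := Nat.succ_le_of_lt (Fin.pos μ)
    omega
  omega

/-- **THE EXACT CONSTRAINT**: `Q_v ψ_φ = κ • φ` — the (1.18) line-sum average of the tilted trial 1-form returns the datum scaled by the k-UNIFORM constant `κ`;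
hence `κ⁻¹ • ψ_φ` lies EXACTLY in the constraint fibre `{W : Q_v W = φ}`. [folklore] -/
theorem QvV_trialV (φ : Tor M → Fin d → E) : QvV n M (trialV n M φ) = fun y μ => ((kappaV d n : ℝ) : ℂ) • φ y μ := by
  funext y μ
  unfold QvV
  rw [← (Equiv.funSplitAt μ (Fin n)).symm.sum_comp, Fintype.sum_prod_type, Finset.sum_comm]
  simp_rw [line_window_sum n M φ y μ]
  rw [← Finset.sum_smul, smul_smul, ← Complex.ofReal_sum, ← Finset.mul_sum, sum_transverse_mass]
  congr 1
  unfold kappaV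
  push_cast
  ring

end Constraint

/-! ## §6 The constraint constant in closed form and its k-UNIFORM bounds -/

/-- `κ = β₁^{d−1}·(n+1)(n+2)(n+3)/(60 n³)` (`d ≥ 1`). [folklore] -/
theorem kappaV_eq {d n : ℕ} (hd : 1 ≤ d) (hn : 0 < n) :
    kappaV d n = beta1 n ^ (d - 1) * (((n : ℝ) + 1) * ((n : ℝ) + 2) * ((n : ℝ) + 3) / (60 * (n : ℝ) ^ 3)) := by
  have hn' : (n : ℝ) ≠ 0 := by exact_mod_cast hn.ne'
  obtain ⟨d', rfl⟩ : ∃ d', d = d' + 1 := ⟨d - 1, by omega⟩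
  simp only [kappaV, mV, Nat.add_sub_cancel, mul_pow]
  field_simp
  ring

/-- **k-UNIFORM BOUNDS** `6^{−(d−1)}/60 ≤ κ ≤ 1` (`d ≥ 1`; `β₁ ∈ [1/6, 1]`, `(n+1)(n+2)(n+3)/(60n³) ∈ [1/60, 2/5]`). [folklore] -/
theorem kappaV_bounds {d n : ℕ} (hd : 1 ≤ d) (hn : 0 < n) : ((1 : ℝ) / 6) ^ (d - 1) / 60 ≤ kappaV d n ∧ kappaV d n ≤ 1 := by
  haveI : NeZero n := ⟨hn.ne'⟩
  have hn' : (0 : ℝ) < n := by exact_mod_cast hn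
  have h1 : (1 : ℝ) ≤ n := by exact_mod_cast hn
  obtain ⟨hβ, hβ0⟩ := beta1_ge n
  have hβ1 : beta1 n ≤ 1 := by
    unfold beta1; rw [div_le_one (by positivity)]; nlinarith
  have hq : (1 : ℝ) / 60 ≤ ((n : ℝ) + 1) * ((n : ℝ) + 2) * ((n : ℝ) + 3) / (60 * (n : ℝ) ^ 3) ∧
      ((n : ℝ) + 1) * ((n : ℝ) + 2) * ((n : ℝ) + 3) / (60 * (n : ℝ) ^ 3) ≤ 2 / 5 := by
    constructor
    · rw [div_le_div_iff₀ (by norm_num) (by positivity)]; nlinarith [mul_nonneg (mul_nonneg hn'.le hn'.le) hn'.le, mul_nonneg hn'.le hn'.le]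
    · rw [div_le_div_iff₀ (by positivity) (by norm_num)]
      nlinarith [mul_nonneg (mul_nonneg hn'.le hn'.le) hn'.le, mul_nonneg hn'.le hn'.le, mul_nonneg (mul_nonneg (sub_nonneg.2 h1) hn'.le) hn'.le]
  rw [kappaV_eq hd hn]
  constructor
  · rw [div_eq_mul_one_div]
    exact mul_le_mul (pow_le_pow_left₀ (by norm_num) hβ _) hq.1 (by norm_num) (pow_nonneg hβ0.le _)
  · calc beta1 n ^ (d - 1) * (((n : ℝ) + 1) * ((n : ℝ) + 2) * ((n : ℝ) + 3) / (60 * (n : ℝ) ^ 3))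
        ≤ 1 ^ (d - 1) * (2 / 5) := mul_le_mul (pow_le_pow_left₀ hβ0.le hβ1 _) hq.2 (by positivity) (by positivity)
      _ ≤ 1 := by norm_num

/-- `0 < κ`. [folklore] -/
theorem kappaV_pos {d n : ℕ} (hd : 1 ≤ d) (hn : 0 < n) : 0 < kappaV d n :=
  lt_of_lt_of_le (by positivity) (kappaV_bounds hd hn).1

end Summit.QuantumFields.BalabanUV.T4Continuum.VectorBlockTrialForm

end
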